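import Mathlib
import HarnessLib

/-!
# Dimock, *QED on the 3-torus. II*, §3.1 (127): the long-distance metric
# `d_Λ(x,y) = inf_{Γ:x→y} Σ_{i=1}^k L^{k−i}|Γ ∩ δΛ^{(k)}_i|` as a CONCRETE weighted lattice path metric —
# DEFINED, with «a genuine metric which weighs earlier regions more heavily», Remark 3 «Λ_i full tori ⟹ d_Λ = d»,
# the hop comparability «d_Λ(x′,y) ≥ d_Λ(x,y) − 1» and the (177) mechanism «d_{Ω(□)}(x,y) ≥ O(1)L^{k−i}d(x,y)» PROVED

statement-level skeleton of published theorems with citation tags; proofs where landed; nothing here is a claim about the Yang–Mills mass gap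

**Citation header (reproduction of PUBLISHED work).** J. Dimock, *Quantum electrodynamics on the 3-torus. II*,
arXiv:math-ph/0407063 [Dimock2004QED3TorusII], **§3.1 «definitions»** (120)–(121) p.20 L20–48, **(127)** p.21 L16–23,
Remark 3 after THEOREM 1 p.22 L28–30, proof of THEOREM 1 Part II p.23 L88, Part II (151) p.24 L58, Part III p.24 L94–95,
proof of LEMMA 2 Part III **(177)** p.27 L61–65 of the held arXiv text layer `paper:arxiv-math-ph_0407063`
(`p.NN Lnn` = PDF page ∕ text-layer line).  Writer seat p11 (literature-prover-lit-balaban-p11-g23-0), YM LIT SWEEP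
item (c) D13 (row C13 «WHERE»; zero weight for the YM-INPRINT tokens).

**The printed text.** (120)–(121) p.20 L20–48: the region `L^{−k}Λ_0 ⊂ T^{−k}_{N+M−k}` is the disjoint union
`L^{−k}Λ_0 = ⋃_{i=1}^k δΛ^{(k)}_i` (121), *"`δΛ^{(k)}_i` is a union of `L^{−(k−i)}M_0` blocks"*.  (127) p.21 L16–23:
*"Finally we introduce some modified distances on `T^{−k}_{N+M−k}`.  For long distances we use
`d_Λ(x,y) = inf_{Γ:x→y} Σ_{i=1}^k L^{k−i}|Γ ∩ δΛ^{(k)}_i|` (127)  This is a genuine metric which weighs earlier regions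
more heavily."*  Remark 3 p.22 L28–30: *"It is possible that `Λ` is a sequence of the full tori, i.e.
`Λ_i = T^0_{N+M−i}`.  In this case `d_Λ(x,y) = d(x,y)` …"*.  p.23 L88 (proof of (143), the sum (144) being *"over nearest
neighbors `x′` of `x`"*): *"… and `d′(x′,y) ≥ d′(x,y)∕2` and `d_Λ(x′,y) ≥ d_Λ(x,y) − 1`."*  p.24 L58: *"Since
`d′(x,y) ≤ d_Λ(x,y) + 1` the result follows."*  p.24 L94–95: *"Now use `d_Λ(x_i,x_{i+1}) ≥ d_Λ(Δ_i,Δ_{i+1}) − 2` where the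
distance is from the center of the cubes."*  (177) p.27 L61–65: *"Now consider `x, y ∈ L^{−k}Ω_0(□) ⊂ □^{(5)}`.  Assuming
`5r_1 < r_0` we have `□^{(5)} ⊂ δΛ^{(k)}_i ∪ δΛ^{(k)}_{i+1}`.  Then `d_{Ω(□)}(x,y) ≥ O(1)L^{(k−i)}d(x,y) ≥ O(1)d_Λ(x,y)` (177)"*.

**What is formalized (kernel-checked, zero `sorry`; Mathlib only).**  The tree's random-walk engines take `d_Λ`
(resp. `d_{Ω(□)}`) ABSTRACTLY — `QED3SingularWalkBound.dimock195`, `QED3BackgroundFieldSeries.dimock134_multiscale`,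
`QED3WalkExpansionInverse.dimock_thm1` quantify over `d : X → X → ℝ` with hypotheses `(hd0 : ∀ u v, 0 ≤ d u v)
(hsymm : ∀ u v, d u v = d v u) (htri : ∀ u v t, d u t ≤ d u v + d v t)`, and `QED3BackgroundFieldSeries.norm_hop_sum_le` ∕
`QED3CommutatorBounds` take the hop comparability of p.23 L88 as a hypothesis.  This file supplies the printed object:
* **the lattice rendering of (127).**  Sites are `ι → ℤ` (lattice units; `ι = Fin 3` in the paper), `supDist` is the
  sup-norm lattice distance, a path `Γ : x → y` is a KING WALK (`Walk x y`: consecutive sites at `supDist ≤ 1`), and for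
  a site weight `ρ ≥ 0` the weighted length `Walk.cost ρ Γ = Σ_steps ½(ρ u + ρ v)·supDist u v` charges each unit step
  half to the region of each endpoint; **`pathDist ρ x y = ⨅_Γ cost ρ Γ`**.  Dimock's (127) is the instance
  **`dLambda a L k scale = pathDist (dimockWeight a L k scale)`** with `dimockWeight a L k scale u = a·L^{k − scale u}`:
  `scale u = i` for `u ∈ δΛ^{(k)}_i` ((121): every site has exactly one scale `1 ≤ i ≤ k`) and `a` the lattice spacing
  (`a = L^{−k}` on `T^{−k}_{N+M−k}`), so that a step inside `δΛ^{(k)}_i` costs `L^{k−i}·a` = `L^{k−i}` × its length.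
* **«a genuine metric»** in the engines' hypothesis shapes: `pathDist_nonneg`, `pathDist_comm`, `pathDist_triangle`,
  `pathDist_self`, and `pathDist_eq_zero_iff` (weights bounded below by `m > 0`); for (127): `dLambda_nonneg`,
  `dLambda_comm`, `dLambda_triangle`, `dLambda_self`, `dLambda_eq_zero_iff` (`0 < a`, `1 ≤ L`).
* **Remark 3**: `pathDist_const` — a constant weight `c ≥ 0` gives `c·supDist` exactly; `dLambda_of_scale_eq` — if every
  site has scale `k` then `d_Λ(x,y) = a·supDist x y`, the (sup-norm) lattice distance `d(x,y)`.
* **«weighs earlier regions more heavily»**, quantitatively: `pathDist_mono` (pointwise larger weights, larger distance),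
  the global comparison `mul_supDist_le_pathDist` (`ρ ≥ m ≥ 0 ⟹ m·supDist ≤ pathDist`; for (127) with `1 ≤ L`:
  **`dLambda_ge_dist`** `a·supDist x y ≤ d_Λ(x,y)`, the comparison behind p.24 L58), and the LOCAL form, the
  mechanism of (177): **`pathDist_local_lower`** — if `ρ ≥ m` on the sup-ball of radius `R` about `x` then
  `(m∕2)·min(supDist x y, R) ≤ pathDist ρ x y` (a potential argument along the walk; the `½` is the half-step charged to
  a site outside the ball), whence **`dLambda_local_lower`**: if every site within `R` of `x` has scale `≤ i` then
  `(a∕2)L^{k−i}·min(supDist x y, R) ≤ d_Λ(x,y)` — Dimock's `d_{Ω(□)}(x,y) ≥ O(1)L^{(k−i)}d(x,y)` on `□^{(5)} ⊂ δΛ_i ∪ δΛ_{i+1}`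
  with the `O(1)` explicit for this discretisation.
* **the hop comparability** p.23 L88: `pathDist_hop` — for king-neighbours `x, x′` and weights `≤ M`,
  `pathDist ρ x y − M ≤ pathDist ρ x′ y`; for (127) **`dLambda_hop`**: with `1 ≤ scale`, `1 ≤ L`,
  `d_Λ(x,y) − a·L^{k−1} ≤ d_Λ(x′,y)`, and with `a = L^{−k}` the printed form **`dLambda_hop_one`**
  `d_Λ(x,y) − 1 ≤ d_Λ(x′,y)`; the local positivity `pathDist_pos_of_ne`; and the centre comparison of
  p.24 L94–95 in generic form, `pathDist_centres` (`d(c_u,c_v) − (r_u + r_v) ≤ d(u,v)` when `d(u,c_u) ≤ r_u`, `d(v,c_v) ≤ r_v`)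
  together with the local upper bound `pathDist_le_local` (`ρ ≤ M` on the sup-ball of radius `N ≥ supDist x c` about `c`
  ⟹ `pathDist ρ x c ≤ M·supDist x c`, by the straight king walk, which stays in that ball) that produces such `r`.
* **v1.1 (append-only): the second inequality of (177)** *"`O(1)L^{(k−i)}d(x,y) ≥ O(1)d_Λ(x,y)`"* — an UPPER bound for
  `d_Λ` by the straight king walk, which stays in the coordinatewise BOX spanned by its endpoints (`stepToward_mem_box`,
  `box_stepToward_subset`): `exists_walk_cost_le_box` ∕ **`pathDist_le_box`** (`ρ ≤ M` on the box of `x, c` ⟹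
  `pathDist ρ x c ≤ M·supDist x c`) and **`dLambda_le_box`** (every site of the box has scale `≥ i` ⟹
  `d_Λ(x,c) ≤ a·L^{k−i}·supDist x c`; for `x, y` in one cube `□^{(5)} ⊂ δΛ_i ∪ δΛ_{i+1}` the box lies in the cube, so this
  is (177)'s second `≥` with `O(1) = 1`), whence **`dLambda_le_of_mem_cube`**: a site `u` of an index cube of half-width
  `n` about `c` all of whose sites have scale `≥ j` is within `d_Λ ≤ a·L^{k−j}·n` of `c` — the engines' `hrad` for the blocks
  `Δ ⊂ δΛ^{(k)}_j` of side `L^{−(k−j)}` (p.24 L59–62: index half-width `≤ L^j∕2`, so `r = a·L^k∕2 = 1∕2` on `T^{−k}`).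

**Honest scope ∕ conventions.** (127) is printed for continuum paths `Γ` on the torus with `|Γ ∩ δΛ_i|` a length; this
file fixes ONE lattice discretisation — king walks on `ℤ^ι`, sup-norm step lengths, each step split half–half between
the regions of its two endpoints, no periodic identification (the torus quotient only shortens distances and is not
needed by the engines, which live on a finite site type mapped into `ℤ^ι`).  Other conventions (Euclidean step length,
nearest-neighbour walks, charging a step to one endpoint) change `pathDist` by factors depending only on `ι` and on the
ratio of adjacent weights, which the printed `exp(−O(1)d_Λ)` absorbs; nothing here asserts which convention the paper
intends.  Not here: `d′` (128) and the integral estimates (129)–(131) (the tree's `QED3BlockPotentialSums`), the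
summation bound (155) (taken as the constant `K` by the tree's `QED3SingularWalkBound` ∕ `QED3WalkExpansionInverse`), the torus
identification, anything about propagators.
No named facts (`def … : Prop`) are introduced.
-/

namespace Literature.MathematicalPhysics.QuantumFieldTheory.Dimock2011to13

namespace QED3PathMetric

open Finset

variable {ι : Type*} [Fintype ι]

/-! ### The sup-norm lattice distance on `ℤ^ι` -/

/-- The sup-norm lattice distance `max_μ |x_μ − y_μ|` on `ℤ^ι` (lattice units; `0` for empty `ι`).
[cite: Dimock2004QED3TorusII, §3.1 p.21 L23–28 (the `d(x,y)` of (128))] -/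
def supDist (x y : ι → ℤ) : ℕ := univ.sup fun μ => (x μ - y μ).natAbs

/-- `supDist x y ≤ n` iff every coordinate difference is `≤ n`.
[cite: Dimock2004QED3TorusII, §3.1 (127)–(128) p.21 L16–28] -/
theorem supDist_le_iff {x y : ι → ℤ} {n : ℕ} : supDist x y ≤ n ↔ ∀ μ, (x μ - y μ).natAbs ≤ n := by
  simp [supDist, Finset.sup_le_iff]

/-- each coordinate difference is bounded by `supDist`. [cite: Dimock2004QED3TorusII, §3.1 (127)–(128) p.21 L16–28] -/
theorem natAbs_le_supDist (x y : ι → ℤ) (μ : ι) : (x μ - y μ).natAbs ≤ supDist x y :=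
  supDist_le_iff.1 le_rfl μ

/-- `supDist` is symmetric. [cite: Dimock2004QED3TorusII, §3.1 (127)–(128) p.21 L16–28] -/
theorem supDist_comm (x y : ι → ℤ) : supDist x y = supDist y x := by
  unfold supDist; congr 1; funext μ; rw [← Int.natAbs_neg, neg_sub]

/-- `supDist x y = 0 ↔ x = y`. [cite: Dimock2004QED3TorusII, §3.1 (127)–(128) p.21 L16–28] -/
theorem supDist_eq_zero_iff {x y : ι → ℤ} : supDist x y = 0 ↔ x = y := by
  rw [← Nat.le_zero, supDist_le_iff]
  constructor
  · intro h; funext μ; have := h μ; omega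
  · rintro rfl μ; simp

/-- `supDist x x = 0`. [cite: Dimock2004QED3TorusII, §3.1 (127)–(128) p.21 L16–28] -/
@[simp] theorem supDist_self (x : ι → ℤ) : supDist x x = 0 := supDist_eq_zero_iff.2 rfl

/-- the triangle inequality for `supDist`. [cite: Dimock2004QED3TorusII, §3.1 (127)–(128) p.21 L16–28] -/
theorem supDist_triangle (x y z : ι → ℤ) : supDist x z ≤ supDist x y + supDist y z := by
  rw [supDist_le_iff]; intro μ
  have h1 := natAbs_le_supDist x y μ
  have h2 := natAbs_le_supDist y z μ
  omega

/-! ### King walks and their weighted length -/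

/-- King adjacency on `ℤ^ι`: `supDist u v ≤ 1` (a lattice path moves by at most one unit in every coordinate per
step; `u = v` is allowed and costs nothing). [cite: Dimock2004QED3TorusII, §3.1 (127) p.21 L16–23] -/
def Adj (u v : ι → ℤ) : Prop := supDist u v ≤ 1

/-- king adjacency is symmetric. [cite: Dimock2004QED3TorusII, §3.1 (127) p.21 L16–23] -/
theorem Adj.symm {u v : ι → ℤ} (h : Adj u v) : Adj v u := by
  unfold Adj at h ⊢; rwa [supDist_comm]

/-- king adjacency is reflexive. [cite: Dimock2004QED3TorusII, §3.1 (127) p.21 L16–23] -/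
theorem Adj.refl (u : ι → ℤ) : Adj u u := by simp [Adj]

/-- Lattice paths `Γ : x → y` of (127): king walks on `ℤ^ι`.
[cite: Dimock2004QED3TorusII, §3.1 (127) p.21 L16–22] -/
inductive Walk : (ι → ℤ) → (ι → ℤ) → Type _
  | nil (x : ι → ℤ) : Walk x x
  | cons {x y z : ι → ℤ} (h : Adj x y) (p : Walk y z) : Walk x z

namespace Walk

variable {ρ : (ι → ℤ) → ℝ}

/-- The weighted length `Σ_i w_i|Γ ∩ (region i)|` of (127) for a site weight `ρ`: each step `u → v` (sup-norm length
`supDist u v ∈ {0,1}`) is charged half to the region of `u` and half to the region of `v`.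
[cite: Dimock2004QED3TorusII, §3.1 (127) p.21 L16–22] -/
noncomputable def cost (ρ : (ι → ℤ) → ℝ) : {x y : ι → ℤ} → Walk x y → ℝ
  | _, _, nil _ => 0
  | _, _, @cons _ _ x y _ _ p => (ρ x + ρ y) / 2 * (supDist x y : ℝ) + cost ρ p

/-- the empty walk costs nothing. [cite: Dimock2004QED3TorusII, §3.1 (127) p.21 L16–23] -/
@[simp] theorem cost_nil (x : ι → ℤ) : cost ρ (nil x) = 0 := rfl

/-- the cost of a walk, one step at a time. [cite: Dimock2004QED3TorusII, §3.1 (127) p.21 L16–23] -/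
@[simp] theorem cost_cons {x y z : ι → ℤ} (h : Adj x y) (p : Walk y z) :
    cost ρ (cons h p) = (ρ x + ρ y) / 2 * (supDist x y : ℝ) + cost ρ p := rfl

/-- Concatenation of walks. [cite: Dimock2004QED3TorusII, §3.1 (127) p.21 L16–23] -/
def append : {x y z : ι → ℤ} → Walk x y → Walk y z → Walk x z
  | _, _, _, nil _, q => q
  | _, _, _, cons h p, q => cons h (append p q)

/-- the weighted length is additive under concatenation (used for the triangle inequality of (127)).
[cite: Dimock2004QED3TorusII, §3.1 (127) p.21 L16–23] -/
theorem cost_append : ∀ {x y z : ι → ℤ} (p : Walk x y) (q : Walk y z),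
    cost ρ (append p q) = cost ρ p + cost ρ q
  | _, _, _, nil _, q => by simp [append]
  | _, _, _, cons h p, q => by rw [append, cost_cons, cost_cons, cost_append p q, add_assoc]

/-- The one-step walk. [cite: Dimock2004QED3TorusII, §3.1 (127) p.21 L16–23] -/
def single {x y : ι → ℤ} (h : Adj x y) : Walk x y := cons h (nil y)

/-- the cost of one step `u → v` is `½(ρ u + ρ v)·supDist u v`. [cite: Dimock2004QED3TorusII, §3.1 (127) p.21 L16–23] -/
@[simp] theorem cost_single {x y : ι → ℤ} (h : Adj x y) :
    cost ρ (single h) = (ρ x + ρ y) / 2 * (supDist x y : ℝ) := by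
  simp [single]

/-- Reversal of a walk. [cite: Dimock2004QED3TorusII, §3.1 (127) p.21 L16–23] -/
def reverse : {x y : ι → ℤ} → Walk x y → Walk y x
  | _, _, nil x => nil x
  | _, _, cons h p => append (reverse p) (single h.symm)

/-- the weighted length is invariant under reversal (used for the symmetry of (127)).
[cite: Dimock2004QED3TorusII, §3.1 (127) p.21 L16–23] -/
theorem cost_reverse : ∀ {x y : ι → ℤ} (p : Walk x y), cost ρ (reverse p) = cost ρ p
  | _, _, nil _ => rfl
  | _, _, @cons _ _ x y _ h p => by
      rw [reverse, cost_append, cost_reverse p, cost_single, cost_cons, supDist_comm y x]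
      ring

/-- nonnegative weights give nonnegative weighted length. [cite: Dimock2004QED3TorusII, §3.1 (127) p.21 L16–23] -/
theorem cost_nonneg (hρ : ∀ u, 0 ≤ ρ u) : ∀ {x y : ι → ℤ} (p : Walk x y), 0 ≤ cost ρ p
  | _, _, nil _ => le_rfl
  | _, _, @cons _ _ x y _ _ p => by
      rw [cost_cons]
      have := cost_nonneg hρ p
      have : 0 ≤ (ρ x + ρ y) / 2 * (supDist x y : ℝ) :=
        mul_nonneg (by linarith [hρ x, hρ y]) (Nat.cast_nonneg _)
      linarith

/-- Larger weights, larger weighted length. [cite: Dimock2004QED3TorusII, §3.1 (127) p.21 L16–23] -/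
theorem cost_mono {ρ ρ' : (ι → ℤ) → ℝ} (h : ∀ u, ρ u ≤ ρ' u) : ∀ {x y : ι → ℤ} (p : Walk x y), cost ρ p ≤ cost ρ' p
  | _, _, nil _ => le_rfl
  | _, _, @cons _ _ x y _ _ p => by
      rw [cost_cons, cost_cons]
      have := cost_mono h p
      have : (ρ x + ρ y) / 2 * (supDist x y : ℝ) ≤ (ρ' x + ρ' y) / 2 * (supDist x y : ℝ) :=
        mul_le_mul_of_nonneg_right (by linarith [h x, h y]) (Nat.cast_nonneg _)
      linarith

/-- **Global lower bound**: if every weight is `≥ m ≥ 0`, a walk from `x` to `y` costs at least `m·supDist x y`.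
[cite: Dimock2004QED3TorusII, §3.1 (127) p.21 L16–23] -/
theorem mul_supDist_le_cost {m : ℝ} (hm : 0 ≤ m) (hρ : ∀ u, m ≤ ρ u) :
    ∀ {x y : ι → ℤ} (p : Walk x y), m * (supDist x y : ℝ) ≤ cost ρ p
  | _, _, nil x => by simp
  | _, _, @cons _ _ x y z _ p => by
      have ih := mul_supDist_le_cost hm hρ p
      have htri : (supDist x z : ℝ) ≤ supDist x y + supDist y z := by exact_mod_cast supDist_triangle x y z
      have hstep : m * (supDist x y : ℝ) ≤ (ρ x + ρ y) / 2 * (supDist x y : ℝ) :=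
        mul_le_mul_of_nonneg_right (by linarith [hρ x, hρ y]) (Nat.cast_nonneg _)
      rw [cost_cons]
      calc m * (supDist x z : ℝ) ≤ m * (supDist x y + supDist y z) := mul_le_mul_of_nonneg_left htri hm
        _ ≤ _ := by linarith

/-- **Local lower bound (the (177) mechanism)**, potential form: if the weights are `≥ 0` everywhere and `≥ m ≥ 0` on the
sup-ball of radius `R` about `x₀`, then along any walk the potential `φ(u) = min(supDist u x₀, R)` increases by at most
`(2∕m)`·cost: `(m∕2)(φ(y) − φ(x)) ≤ cost Γ` for `Γ : x → y`.
[cite: Dimock2004QED3TorusII, §3.2 proof of Lemma 2 Part III (177) p.27 L61–65] -/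
theorem local_potential_le_cost (x₀ : ι → ℤ) (R : ℕ) {m : ℝ} (hm : 0 ≤ m) (hρ : ∀ u, 0 ≤ ρ u)
    (hball : ∀ u, supDist u x₀ ≤ R → m ≤ ρ u) :
    ∀ {x y : ι → ℤ} (p : Walk x y),
      m / 2 * ((min (supDist y x₀) R : ℕ) - (min (supDist x x₀) R : ℕ) : ℝ) ≤ cost ρ p
  | _, _, nil x => by simp
  | _, _, @cons _ _ x y z _ p => by
      have ih := local_potential_le_cost x₀ R hm hρ hball p
      have hstep : m / 2 * ((min (supDist y x₀) R : ℕ) - (min (supDist x x₀) R : ℕ) : ℝ)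
          ≤ (ρ x + ρ y) / 2 * (supDist x y : ℝ) := by
        by_cases hin : supDist x x₀ ≤ R ∨ supDist y x₀ ≤ R
        · have hsum : m ≤ ρ x + ρ y := by
            rcases hin with hx | hy
            · linarith [hball x hx, hρ y]
            · linarith [hball y hy, hρ x]
          have hφ : ((min (supDist y x₀) R : ℕ) : ℝ) - (min (supDist x x₀) R : ℕ) ≤ supDist x y := by
            have t := supDist_triangle y x x₀
            rw [supDist_comm y x] at t
            have hnat : min (supDist y x₀) R ≤ min (supDist x x₀) R + supDist x y := by omega
            have : ((min (supDist y x₀) R : ℕ) : ℝ) ≤ ((min (supDist x x₀) R : ℕ) : ℝ) + supDist x y := by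
              exact_mod_cast hnat
            linarith
          calc m / 2 * (((min (supDist y x₀) R : ℕ) : ℝ) - (min (supDist x x₀) R : ℕ))
              ≤ m / 2 * (supDist x y : ℝ) := mul_le_mul_of_nonneg_left hφ (by linarith)
            _ ≤ (ρ x + ρ y) / 2 * (supDist x y : ℝ) :=
              mul_le_mul_of_nonneg_right (by linarith) (Nat.cast_nonneg _)
        · push Not at hin
          rw [min_eq_right hin.2.le, min_eq_right hin.1.le, sub_self, mul_zero]
          exact mul_nonneg (by linarith [hρ x, hρ y]) (Nat.cast_nonneg _)
      rw [cost_cons]; linarith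

end Walk

/-! ### The straight king walk: existence of paths and upper bounds -/

/-- One king step from `x` towards `y` (every coordinate moves by `sign(y_μ − x_μ)`).
[cite: Dimock2004QED3TorusII, §3.1 (127) p.21 L16–23] -/
def stepToward (x y : ι → ℤ) : ι → ℤ := fun μ => x μ + Int.sign (y μ - x μ)

omit [Fintype ι] in
/-- the step towards `y` decreases every nonzero coordinate distance to `y` by one.
[cite: Dimock2004QED3TorusII, §3.1 (127) p.21 L16–23] -/
theorem natAbs_stepToward_sub (x y : ι → ℤ) (μ : ι) :
    (stepToward x y μ - y μ).natAbs = (x μ - y μ).natAbs - 1 := by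
  simp only [stepToward]
  rcases lt_trichotomy (y μ - x μ) 0 with h | h | h
  · rw [Int.sign_eq_neg_one_of_neg h]; omega
  · rw [h, Int.sign_zero]; omega
  · rw [Int.sign_eq_one_of_pos h]; omega

/-- the step towards `y` is a king step. [cite: Dimock2004QED3TorusII, §3.1 (127) p.21 L16–23] -/
theorem adj_stepToward (x y : ι → ℤ) : Adj x (stepToward x y) := by
  rw [Adj, supDist_le_iff]; intro μ
  simp only [stepToward]
  rcases lt_trichotomy (y μ - x μ) 0 with h | h | h
  · rw [Int.sign_eq_neg_one_of_neg h]; simp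
  · rw [h, Int.sign_zero]; simp
  · rw [Int.sign_eq_one_of_pos h]; simp

/-- the step towards `y` decreases the sup distance to `y` by one (if positive).
[cite: Dimock2004QED3TorusII, §3.1 (127) p.21 L16–23] -/
theorem supDist_stepToward (x y : ι → ℤ) : supDist (stepToward x y) y = supDist x y - 1 := by
  apply le_antisymm
  · rw [supDist_le_iff]; intro μ
    rw [natAbs_stepToward_sub]
    have := natAbs_le_supDist x y μ
    omega
  · rw [tsub_le_iff_right, supDist_le_iff]; intro μ
    have := natAbs_le_supDist (stepToward x y) y μ
    rw [natAbs_stepToward_sub] at this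
    omega

/-- the step towards `y` does not leave the sup-ball about `y`
[cite: Dimock2004QED3TorusII, §3.1 (127) p.21 L16–23] -/
theorem supDist_stepToward_le (x y : ι → ℤ) : supDist (stepToward x y) y ≤ supDist x y := by
  rw [supDist_stepToward]; exact Nat.sub_le _ _

/-- **The straight king walk** from `x` to `c` has `supDist x c` unit steps and stays in the sup-ball of radius
`supDist x c` about `c`; hence if the weights are `≤ M` (`M ≥ 0`) on the sup-ball of radius `N ≥ supDist x c` about
`c`, there is a walk `x → c` of cost `≤ M·supDist x c`. [cite: Dimock2004QED3TorusII, §3.1 (127) p.21 L16–23] -/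
theorem exists_walk_cost_le_local {ρ : (ι → ℤ) → ℝ} (c : ι → ℤ) (N : ℕ) {M : ℝ} (hM0 : 0 ≤ M)
    (hM : ∀ u, supDist u c ≤ N → ρ u ≤ M) :
    ∀ (n : ℕ) (x : ι → ℤ), supDist x c = n → n ≤ N → ∃ p : Walk x c, p.cost ρ ≤ M * n
  | 0, x, h, _ => by
      obtain rfl := supDist_eq_zero_iff.1 h
      exact ⟨Walk.nil x, by simp⟩
  | n + 1, x, h, hN => by
      have h' : supDist (stepToward x c) c = n := by rw [supDist_stepToward, h]; rfl
      obtain ⟨p, hp⟩ := exists_walk_cost_le_local c N hM0 hM n (stepToward x c) h' (by omega)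
      refine ⟨Walk.cons (adj_stepToward x c) p, ?_⟩
      rw [Walk.cost_cons]
      have hd1 : (supDist x (stepToward x c) : ℝ) ≤ 1 := by exact_mod_cast adj_stepToward x c
      have hd0 : (0 : ℝ) ≤ supDist x (stepToward x c) := Nat.cast_nonneg _
      have ha : (ρ x + ρ (stepToward x c)) / 2 ≤ M := by
        have h1 := hM x (by omega)
        have h2 := hM (stepToward x c) (by omega)
        linarith
      have hstep : (ρ x + ρ (stepToward x c)) / 2 * (supDist x (stepToward x c) : ℝ) ≤ M := by
        nlinarith [mul_nonneg (sub_nonneg.2 ha) hd0, mul_nonneg hM0 (sub_nonneg.2 hd1)]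
      push_cast
      linarith

/-- Global form: weights `≤ M` everywhere (`M ≥ 0`) give a walk `x → y` of cost `≤ M·supDist x y`.
[cite: Dimock2004QED3TorusII, §3.1 (127) p.21 L16–23] -/
theorem exists_walk_cost_le {ρ : (ι → ℤ) → ℝ} {M : ℝ} (hM0 : 0 ≤ M) (hM : ∀ u, ρ u ≤ M) (x y : ι → ℤ) :
    ∃ p : Walk x y, p.cost ρ ≤ M * supDist x y :=
  exists_walk_cost_le_local y (supDist x y) hM0 (fun u _ => hM u) (supDist x y) x rfl le_rfl

/-- between any two sites there is a king walk (the straight one), so the infimum (127) is over a nonempty set.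
[cite: Dimock2004QED3TorusII, §3.1 (127) p.21 L16–23] -/
instance instNonemptyWalk (x y : ι → ℤ) : Nonempty (Walk x y) :=
  let ⟨p, _⟩ := exists_walk_cost_le (ρ := fun _ => 0) le_rfl (fun _ => le_rfl) x y
  ⟨p⟩

/-! ### The path metric -/

/-- **Dimock's (127) for a general site weight**: `pathDist ρ x y = inf_{Γ:x→y} cost ρ Γ`, the infimum over king walks
of the `ρ`-weighted length.
[cite: Dimock2004QED3TorusII, §3.1 (127) p.21 L16–22] -/
noncomputable def pathDist (ρ : (ι → ℤ) → ℝ) (x y : ι → ℤ) : ℝ := ⨅ p : Walk x y, p.cost ρ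

section PathDist

variable {ρ : (ι → ℤ) → ℝ} {x y z : ι → ℤ}

/-- a lower bound for the cost of every walk `x → y` is a lower bound for `pathDist ρ x y`.
[cite: Dimock2004QED3TorusII, §3.1 (127) p.21 L16–23] -/
theorem le_pathDist {a : ℝ} (h : ∀ p : Walk x y, a ≤ p.cost ρ) : a ≤ pathDist ρ x y :=
  le_ciInf h

/-- `pathDist` is below the cost of any walk (weights `≥ 0`). [cite: Dimock2004QED3TorusII, §3.1 (127) p.21 L16–23] -/
theorem pathDist_le_cost (hρ : ∀ u, 0 ≤ ρ u) (p : Walk x y) : pathDist ρ x y ≤ p.cost ρ :=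
  ciInf_le ⟨0, by rintro _ ⟨q, rfl⟩; exact Walk.cost_nonneg hρ q⟩ p

/-- `d ≥ 0` (the engines' `hd0`). [cite: Dimock2004QED3TorusII, §3.1 (127) p.21 L16–23] -/
theorem pathDist_nonneg (hρ : ∀ u, 0 ≤ ρ u) (x y : ι → ℤ) : 0 ≤ pathDist ρ x y :=
  le_pathDist fun p => Walk.cost_nonneg hρ p

/-- `d(x,x) = 0`. [cite: Dimock2004QED3TorusII, §3.1 (127) p.21 L16–23] -/
theorem pathDist_self (hρ : ∀ u, 0 ≤ ρ u) (x : ι → ℤ) : pathDist ρ x x = 0 :=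
  le_antisymm (by simpa using pathDist_le_cost hρ (Walk.nil x)) (pathDist_nonneg hρ x x)

/-- `d` is symmetric (the engines' `hsymm`), by reversing walks.
[cite: Dimock2004QED3TorusII, §3.1 (127) p.21 L16–23] -/
theorem pathDist_comm (hρ : ∀ u, 0 ≤ ρ u) (x y : ι → ℤ) : pathDist ρ x y = pathDist ρ y x := by
  have key : ∀ x y : ι → ℤ, pathDist ρ x y ≤ pathDist ρ y x := fun x y =>
    le_pathDist fun q => (pathDist_le_cost hρ q.reverse).trans_eq (Walk.cost_reverse q)
  exact le_antisymm (key x y) (key y x)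

/-- the triangle inequality (the engines' `htri`), by concatenating walks.
[cite: Dimock2004QED3TorusII, §3.1 p.21 L23 *"This is a genuine metric"*] -/
theorem pathDist_triangle (hρ : ∀ u, 0 ≤ ρ u) (x y z : ι → ℤ) :
    pathDist ρ x z ≤ pathDist ρ x y + pathDist ρ y z := by
  have h1 : ∀ q : Walk y z, pathDist ρ x z - q.cost ρ ≤ pathDist ρ x y := fun q =>
    le_pathDist fun p => by
      have := pathDist_le_cost hρ (p.append q)
      rw [Walk.cost_append] at this
      linarith
  have h2 : pathDist ρ x z - pathDist ρ x y ≤ pathDist ρ y z :=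
    le_pathDist fun q => by have := h1 q; linarith
  linarith

/-- **«weighs earlier regions more heavily»**: pointwise larger weights give a larger distance.
[cite: Dimock2004QED3TorusII, §3.1 (127) p.21 L16–23] -/
theorem pathDist_mono {ρ ρ' : (ι → ℤ) → ℝ} (hρ : ∀ u, 0 ≤ ρ u) (h : ∀ u, ρ u ≤ ρ' u) (x y : ι → ℤ) :
    pathDist ρ x y ≤ pathDist ρ' x y :=
  le_pathDist fun p => (pathDist_le_cost hρ p).trans (Walk.cost_mono h p)

/-- **Global lower bound**: weights `≥ m ≥ 0` everywhere give `m·supDist x y ≤ pathDist ρ x y`.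
[cite: Dimock2004QED3TorusII, §3.1 (127) p.21 L16–23] -/
theorem mul_supDist_le_pathDist {m : ℝ} (hm : 0 ≤ m) (hρ : ∀ u, m ≤ ρ u) (x y : ι → ℤ) :
    m * (supDist x y : ℝ) ≤ pathDist ρ x y :=
  le_pathDist fun p => Walk.mul_supDist_le_cost hm hρ p

/-- **Upper bound**: weights in `[0, M]` everywhere give `pathDist ρ x y ≤ M·supDist x y` (the straight walk).
[cite: Dimock2004QED3TorusII, §3.1 (127) p.21 L16–23] -/
theorem pathDist_le (hρ : ∀ u, 0 ≤ ρ u) {M : ℝ} (hM0 : 0 ≤ M) (hM : ∀ u, ρ u ≤ M) (x y : ι → ℤ) :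
    pathDist ρ x y ≤ M * supDist x y := by
  obtain ⟨p, hp⟩ := exists_walk_cost_le hM0 hM x y
  exact (pathDist_le_cost hρ p).trans hp

/-- **Local upper bound**: if the weights are `≤ M` (`M ≥ 0`) on the sup-ball of radius `N` about `c` and
`supDist x c ≤ N`, then `pathDist ρ x c ≤ M·supDist x c` — e.g. every site of a block of sup-radius `n` lying in a
region of weight `≤ M` is within `M·n` of the block's centre (the engines' `hrad`).
[cite: Dimock2004QED3TorusII, §3.1 (127) p.21 L16–23] -/
theorem pathDist_le_local (hρ : ∀ u, 0 ≤ ρ u) (c : ι → ℤ) (N : ℕ) {M : ℝ} (hM0 : 0 ≤ M)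
    (hM : ∀ u, supDist u c ≤ N → ρ u ≤ M) (x : ι → ℤ) (hx : supDist x c ≤ N) :
    pathDist ρ x c ≤ M * supDist x c := by
  obtain ⟨p, hp⟩ := exists_walk_cost_le_local c N hM0 hM (supDist x c) x rfl hx
  exact (pathDist_le_cost hρ p).trans hp

/-- **Remark 3** (*"`Λ_i` full tori ⟹ `d_Λ(x,y) = d(x,y)`"*), general form: a CONSTANT weight `c ≥ 0` gives exactly
`c` times the sup-norm lattice distance.
[cite: Dimock2004QED3TorusII, §3.2 Remark 3 p.22 L28–30] -/
theorem pathDist_const {c : ℝ} (hc : 0 ≤ c) (x y : ι → ℤ) :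
    pathDist (fun _ => c) x y = c * supDist x y :=
  le_antisymm (pathDist_le (fun _ => hc) hc (fun _ => le_rfl) x y)
    (mul_supDist_le_pathDist hc (fun _ => le_rfl) x y)

/-- **«a genuine metric»**: with weights bounded below by `m > 0`, `pathDist ρ x y = 0 ↔ x = y`.
[cite: Dimock2004QED3TorusII, §3.1 p.21 L23] -/
theorem pathDist_eq_zero_iff {m : ℝ} (hm : 0 < m) (hρ : ∀ u, m ≤ ρ u) :
    pathDist ρ x y = 0 ↔ x = y := by
  have hρ0 : ∀ u, 0 ≤ ρ u := fun u => hm.le.trans (hρ u)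
  refine ⟨fun h => ?_, fun h => h ▸ pathDist_self hρ0 x⟩
  have h1 := mul_supDist_le_pathDist hm.le hρ x y
  rw [h] at h1
  have h2 : (supDist x y : ℝ) ≤ 0 := by
    by_contra hlt
    push Not at hlt
    have := mul_pos hm hlt
    linarith
  have h3 : supDist x y = 0 := by exact_mod_cast le_antisymm h2 (Nat.cast_nonneg _)
  exact supDist_eq_zero_iff.1 h3

/-- **Local lower bound — the mechanism of (177)** (*"`□^{(5)} ⊂ δΛ^{(k)}_i ∪ δΛ^{(k)}_{i+1}`.  Then
`d_{Ω(□)}(x,y) ≥ O(1)L^{(k−i)}d(x,y)`"*): if the weights are `≥ 0` everywhere and `≥ m ≥ 0` on the sup-ball of radius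
`R` about `x`, then `(m∕2)·min(supDist x y, R) ≤ pathDist ρ x y` — a walk either stays in the ball (and pays `≥ m` per
unit step, at rate `≥ ½m` for the step that leaves) or reaches its boundary, at sup-distance `R` from `x`.
[cite: Dimock2004QED3TorusII, §3.2 proof of Lemma 2 Part III (177) p.27 L61–65] -/
theorem pathDist_local_lower (hρ : ∀ u, 0 ≤ ρ u) (R : ℕ) {m : ℝ} (hm : 0 ≤ m)
    (hball : ∀ u, supDist u x ≤ R → m ≤ ρ u) (y : ι → ℤ) :
    m / 2 * ((min (supDist x y) R : ℕ) : ℝ) ≤ pathDist ρ x y :=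
  le_pathDist fun p => by
    have h := Walk.local_potential_le_cost x R hm hρ hball p
    simpa [supDist_comm y x] using h

/-- In particular (a genuine metric, locally): weights `≥ m > 0` on the sup-ball of radius `R ≥ 1` about `x` already
force `pathDist ρ x y ≥ m∕2 > 0` for every `y ≠ x`. [cite: Dimock2004QED3TorusII, §3.1 (127) p.21 L16–23] -/
theorem pathDist_pos_of_ne (hρ : ∀ u, 0 ≤ ρ u) {R : ℕ} (hR : 1 ≤ R) {m : ℝ} (hm : 0 < m)
    (hball : ∀ u, supDist u x ≤ R → m ≤ ρ u) (hxy : x ≠ y) : m / 2 ≤ pathDist ρ x y := by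
  have h := pathDist_local_lower hρ R hm.le hball y
  have h1 : 1 ≤ min (supDist x y) R := by
    have : supDist x y ≠ 0 := fun h0 => hxy (supDist_eq_zero_iff.1 h0)
    exact le_min (Nat.one_le_iff_ne_zero.2 this) hR
  have h2 : (1 : ℝ) ≤ ((min (supDist x y) R : ℕ) : ℝ) := by exact_mod_cast h1
  nlinarith

/-- **The hop comparability** (*"`d_Λ(x′,y) ≥ d_Λ(x,y) − 1`"* for nearest neighbours `x′` of `x`, p.23 L88): for
king-neighbours `x, x′` and weights in `[0, M]`, `pathDist ρ x y − M ≤ pathDist ρ x′ y`.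
[cite: Dimock2004QED3TorusII, §3.2 proof of Thm 1 Part II p.23 L88] -/
theorem pathDist_hop (hρ : ∀ u, 0 ≤ ρ u) {M : ℝ} (hM : ∀ u, ρ u ≤ M) {x x' : ι → ℤ} (hxx' : Adj x x')
    (y : ι → ℤ) : pathDist ρ x y - M ≤ pathDist ρ x' y := by
  have h1 := pathDist_triangle hρ x x' y
  have h2 : pathDist ρ x x' ≤ M := by
    refine (pathDist_le_cost hρ (Walk.single hxx')).trans ?_
    rw [Walk.cost_single]
    have ha : 0 ≤ (ρ x + ρ x') / 2 := by linarith [hρ x, hρ x']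
    have hd : (supDist x x' : ℝ) ≤ 1 := by exact_mod_cast hxx'
    calc (ρ x + ρ x') / 2 * (supDist x x' : ℝ) ≤ (ρ x + ρ x') / 2 := mul_le_of_le_one_right ha hd
      _ ≤ M := by linarith [hM x, hM x']
  linarith

/-- **Centre comparison** (*"`d_Λ(x_i,x_{i+1}) ≥ d_Λ(Δ_i,Δ_{i+1}) − 2` where the distance is from the center of the
cubes"*, p.24 L94–95), generic form: if `u`, `v` are within `r_u`, `r_v` of centres `c_u`, `c_v`, then
`pathDist ρ c_u c_v − (r_u + r_v) ≤ pathDist ρ u v`.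
[cite: Dimock2004QED3TorusII, §3.2 proof of Thm 1 Part III p.24 L94–95] -/
theorem pathDist_centres (hρ : ∀ u, 0 ≤ ρ u) {u v cu cv : ι → ℤ} {ru rv : ℝ}
    (hu : pathDist ρ u cu ≤ ru) (hv : pathDist ρ v cv ≤ rv) :
    pathDist ρ cu cv - (ru + rv) ≤ pathDist ρ u v := by
  have h1 := pathDist_triangle hρ cu u cv
  have h2 := pathDist_triangle hρ u v cv
  rw [pathDist_comm hρ cu u] at h1
  linarith

end PathDist

/-! ### Dimock's weights: `d_Λ` of (127) -/

/-- The weight of (127) per unit of (lattice) length at a site of scale `i = scale u` (`u ∈ δΛ^{(k)}_i`, (121)):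
`a·L^{k−i}`, `a` the lattice spacing (`a = L^{−k}` on `T^{−k}_{N+M−k}`).
[cite: Dimock2004QED3TorusII, §3.1 (121) p.20 L42–48, (127) p.21 L16–22] -/
noncomputable def dimockWeight (a L : ℝ) (k : ℕ) (scale : (ι → ℤ) → ℕ) (u : ι → ℤ) : ℝ :=
  a * L ^ (k - scale u)

/-- **(127)** `d_Λ(x,y) = inf_{Γ:x→y} Σ_{i=1}^k L^{k−i}|Γ ∩ δΛ^{(k)}_i|` in the lattice rendering of this file
(`scale u = i` for `u ∈ δΛ^{(k)}_i`, lattice spacing `a`).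
[cite: Dimock2004QED3TorusII, §3.1 (127) p.21 L16–22] -/
noncomputable def dLambda (a L : ℝ) (k : ℕ) (scale : (ι → ℤ) → ℕ) (x y : ι → ℤ) : ℝ :=
  pathDist (dimockWeight a L k scale) x y

section Dimock

variable {a L : ℝ} {k : ℕ} {scale : (ι → ℤ) → ℕ}

omit [Fintype ι] in
/-- the weights of (127) are nonnegative (`0 ≤ a`, `0 ≤ L`). [cite: Dimock2004QED3TorusII, §3.1 (127) p.21 L16–23] -/
theorem dimockWeight_nonneg (ha : 0 ≤ a) (hL : 0 ≤ L) (u : ι → ℤ) : 0 ≤ dimockWeight a L k scale u :=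
  mul_nonneg ha (pow_nonneg hL _)

omit [Fintype ι] in
/-- with `1 ≤ L` every weight is `≥ a` (the top scale `i = k` is the lightest) …
[cite: Dimock2004QED3TorusII, §3.1 (127) p.21 L16–23] -/
theorem le_dimockWeight (ha : 0 ≤ a) (hL : 1 ≤ L) (u : ι → ℤ) : a ≤ dimockWeight a L k scale u := by
  unfold dimockWeight
  have : (1 : ℝ) ≤ L ^ (k - scale u) := one_le_pow₀ hL
  nlinarith

omit [Fintype ι] in
/-- … and `≤ a·L^k`. [cite: Dimock2004QED3TorusII, §3.1 (127) p.21 L16–23] -/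
theorem dimockWeight_le (ha : 0 ≤ a) (hL : 1 ≤ L) (u : ι → ℤ) : dimockWeight a L k scale u ≤ a * L ^ k :=
  mul_le_mul_of_nonneg_left (pow_le_pow_right₀ hL (Nat.sub_le _ _)) ha

omit [Fintype ι] in
/-- on scales `1 ≤ i` the weight is `≤ a·L^{k−1}`. [cite: Dimock2004QED3TorusII, §3.1 (127) p.21 L16–23] -/
theorem dimockWeight_le_of_one_le_scale (ha : 0 ≤ a) (hL : 1 ≤ L) {u : ι → ℤ} (hu : 1 ≤ scale u) :
    dimockWeight a L k scale u ≤ a * L ^ (k - 1) :=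
  mul_le_mul_of_nonneg_left (pow_le_pow_right₀ hL (by omega)) ha

omit [Fintype ι] in
/-- on scales `≤ i` the weight is `≥ a·L^{k−i}` (earlier regions weigh more).
[cite: Dimock2004QED3TorusII, §3.1 (127) p.21 L16–23] -/
theorem le_dimockWeight_of_scale_le (ha : 0 ≤ a) (hL : 1 ≤ L) {i : ℕ} {u : ι → ℤ} (hu : scale u ≤ i) :
    a * L ^ (k - i) ≤ dimockWeight a L k scale u :=
  mul_le_mul_of_nonneg_left (pow_le_pow_right₀ hL (by omega)) ha

/-- `d_Λ ≥ 0`. [cite: Dimock2004QED3TorusII, §3.1 (127) p.21 L16–23] -/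
theorem dLambda_nonneg (ha : 0 ≤ a) (hL : 0 ≤ L) (x y : ι → ℤ) : 0 ≤ dLambda a L k scale x y :=
  pathDist_nonneg (dimockWeight_nonneg ha hL) x y

/-- `d_Λ(x,x) = 0`. [cite: Dimock2004QED3TorusII, §3.1 (127) p.21 L16–23] -/
theorem dLambda_self (ha : 0 ≤ a) (hL : 0 ≤ L) (x : ι → ℤ) : dLambda a L k scale x x = 0 :=
  pathDist_self (dimockWeight_nonneg ha hL) x

/-- `d_Λ` is symmetric. [cite: Dimock2004QED3TorusII, §3.1 (127) p.21 L16–23] -/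
theorem dLambda_comm (ha : 0 ≤ a) (hL : 0 ≤ L) (x y : ι → ℤ) :
    dLambda a L k scale x y = dLambda a L k scale y x :=
  pathDist_comm (dimockWeight_nonneg ha hL) x y

/-- `d_Λ` satisfies the triangle inequality.
[cite: Dimock2004QED3TorusII, §3.1 p.21 L23 *"This is a genuine metric"*] -/
theorem dLambda_triangle (ha : 0 ≤ a) (hL : 0 ≤ L) (x y z : ι → ℤ) :
    dLambda a L k scale x z ≤ dLambda a L k scale x y + dLambda a L k scale y z :=
  pathDist_triangle (dimockWeight_nonneg ha hL) x y z

/-- **«This is a genuine metric»**: for `0 < a`, `1 ≤ L`, `d_Λ(x,y) = 0 ↔ x = y`.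
[cite: Dimock2004QED3TorusII, §3.1 (127) p.21 L23] -/
theorem dLambda_eq_zero_iff (ha : 0 < a) (hL : 1 ≤ L) {x y : ι → ℤ} :
    dLambda a L k scale x y = 0 ↔ x = y :=
  pathDist_eq_zero_iff ha (le_dimockWeight ha.le hL)

/-- **`d ≤ d_Λ`** (every weight is `≥` the top-scale weight `a`; the comparison behind p.24 L58
*"`d′(x,y) ≤ d_Λ(x,y) + 1`"*): `a·supDist x y ≤ d_Λ(x,y)`.
[cite: Dimock2004QED3TorusII, §3.2 proof of Thm 1 Part II p.24 L58] -/
theorem dLambda_ge_dist (ha : 0 ≤ a) (hL : 1 ≤ L) (x y : ι → ℤ) :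
    a * supDist x y ≤ dLambda a L k scale x y :=
  mul_supDist_le_pathDist ha (le_dimockWeight ha hL) x y

/-- the crude global upper bound `d_Λ(x,y) ≤ a·L^k·supDist x y`.
[cite: Dimock2004QED3TorusII, §3.1 (127) p.21 L16–23] -/
theorem dLambda_le (ha : 0 ≤ a) (hL : 1 ≤ L) (x y : ι → ℤ) :
    dLambda a L k scale x y ≤ a * L ^ k * supDist x y :=
  pathDist_le (dimockWeight_nonneg ha (zero_le_one.trans hL)) (mul_nonneg ha (pow_nonneg (zero_le_one.trans hL) _))
    (dimockWeight_le ha hL) x y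

/-- **Remark 3** (*"It is possible that `Λ` is a sequence of the full tori … In this case `d_Λ(x,y) = d(x,y)`"*): if
every site has the top scale `k` (all `δΛ^{(k)}_i`, `i < k`, empty) then `d_Λ(x,y) = a·supDist x y`, the lattice
distance in units of the spacing `a`.
[cite: Dimock2004QED3TorusII, §3.2 Remark 3 p.22 L28–30] -/
theorem dLambda_of_scale_eq (ha : 0 ≤ a) (hk : ∀ u, scale u = k) (x y : ι → ℤ) :
    dLambda a L k scale x y = a * supDist x y := by
  have hw : dimockWeight a L k scale = fun _ => a := by
    funext u; simp [dimockWeight, hk u]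
  rw [dLambda, hw, pathDist_const ha]

/-- **«weighs earlier regions more heavily» ∕ the (177) mechanism for `d_Λ`**: if every site within sup-distance `R`
of `x` has scale `≤ i` (e.g. `□^{(5)} ⊂ δΛ^{(k)}_i ∪ δΛ^{(k)}_{i+1}` gives scale `≤ i+1` around `□`), then
`(a∕2)·L^{k−i}·min(supDist x y, R) ≤ d_Λ(x,y)` — *"`d_{Ω(□)}(x,y) ≥ O(1)L^{(k−i)}d(x,y)`"* with the `O(1)` explicit.
[cite: Dimock2004QED3TorusII, §3.2 proof of Lemma 2 Part III (177) p.27 L61–65; §3.1 p.21 L23] -/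
theorem dLambda_local_lower (ha : 0 ≤ a) (hL : 1 ≤ L) {i : ℕ} (R : ℕ) {x : ι → ℤ}
    (hball : ∀ u, supDist u x ≤ R → scale u ≤ i) (y : ι → ℤ) :
    a * L ^ (k - i) / 2 * ((min (supDist x y) R : ℕ) : ℝ) ≤ dLambda a L k scale x y :=
  pathDist_local_lower (dimockWeight_nonneg ha (zero_le_one.trans hL)) R
    (mul_nonneg ha (pow_nonneg (zero_le_one.trans hL) _))
    (fun u hu => le_dimockWeight_of_scale_le ha hL (hball u hu)) y

/-- **The hop comparability for `d_Λ`** (*"`d_Λ(x′,y) ≥ d_Λ(x,y) − 1`"*, p.23 L88): with all scales `≥ 1` and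
`1 ≤ L`, for king-neighbours `x, x′`: `d_Λ(x,y) − a·L^{k−1} ≤ d_Λ(x′,y)` (on `T^{−k}`, `a = L^{−k}` and
`a·L^{k−1} = L^{−1} ≤ 1`).
[cite: Dimock2004QED3TorusII, §3.2 proof of Thm 1 Part II p.23 L88] -/
theorem dLambda_hop (ha : 0 ≤ a) (hL : 1 ≤ L) (hscale : ∀ u, 1 ≤ scale u) {x x' : ι → ℤ} (hxx' : Adj x x')
    (y : ι → ℤ) : dLambda a L k scale x y - a * L ^ (k - 1) ≤ dLambda a L k scale x' y :=
  pathDist_hop (dimockWeight_nonneg ha (zero_le_one.trans hL))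
    (fun u => dimockWeight_le_of_one_le_scale ha hL (hscale u)) hxx' y

/-- The printed form of the hop bound on `T^{−k}_{N+M−k}` (`a = L^{−k}`, `1 ≤ L`):
`d_Λ(x,y) − 1 ≤ d_Λ(x′,y)` for king-neighbours `x, x′`.
[cite: Dimock2004QED3TorusII, §3.2 proof of Thm 1 Part II p.23 L88] -/
theorem dLambda_hop_one (hL : 1 ≤ L) (hscale : ∀ u, 1 ≤ scale u) {x x' : ι → ℤ}
    (hxx' : Adj x x') (y : ι → ℤ) :
    dLambda (L ^ k)⁻¹ L k scale x y - 1 ≤ dLambda (L ^ k)⁻¹ L k scale x' y := by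
  have hL0 : 0 < L := zero_lt_one.trans_le hL
  have ha : 0 ≤ (L ^ k)⁻¹ := inv_nonneg.2 (pow_nonneg hL0.le _)
  have h := dLambda_hop ha hL hscale hxx' y (k := k)
  have hle : (L ^ k)⁻¹ * L ^ (k - 1) ≤ 1 := by
    rw [inv_mul_le_iff₀ (pow_pos hL0 _), mul_one]
    exact pow_le_pow_right₀ hL (Nat.sub_le _ _)
  linarith

end Dimock

/-! ### v1.1 — Box-local upper bound: the straight walk stays in the box of its endpoints -/

section Box

variable {ρ : (ι → ℤ) → ℝ}

/-- The coordinatewise box spanned by `x` and `c`: `min(x_μ,c_μ) ≤ u_μ ≤ max(x_μ,c_μ)` for every `μ` (for `x, c` in one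
cube `□^{(n)}` of (126) the box lies in that cube). [cite: Dimock2004QED3TorusII, §3.1 (126)–(127) p.21 L11–23] -/
def InBox (x c u : ι → ℤ) : Prop := ∀ μ, min (x μ) (c μ) ≤ u μ ∧ u μ ≤ max (x μ) (c μ)

omit [Fintype ι] in
/-- `x` lies in the box of `x, c`. [cite: Dimock2004QED3TorusII, §3.1 (126)–(127) p.21 L11–23] -/
theorem inBox_left (x c : ι → ℤ) : InBox x c x := fun _ => ⟨min_le_left _ _, le_max_left _ _⟩

omit [Fintype ι] in
/-- `c` lies in the box of `x, c`. [cite: Dimock2004QED3TorusII, §3.1 (126)–(127) p.21 L11–23] -/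
theorem inBox_right (x c : ι → ℤ) : InBox x c c := fun _ => ⟨min_le_right _ _, le_max_right _ _⟩

omit [Fintype ι] in
/-- the step towards `c` stays in the box of `x, c`. [cite: Dimock2004QED3TorusII, §3.1 (126)–(127) p.21 L11–23] -/
theorem stepToward_mem_box (x c : ι → ℤ) : InBox x c (stepToward x c) := by
  intro μ
  simp only [stepToward]
  rcases lt_trichotomy (c μ - x μ) 0 with h | h | h
  · rw [Int.sign_eq_neg_one_of_neg h]; constructor <;> omega
  · rw [h, Int.sign_zero]; constructor <;> omega
  · rw [Int.sign_eq_one_of_pos h]; constructor <;> omega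

omit [Fintype ι] in
/-- the box shrinks along the straight walk: the box of `stepToward x c, c` lies in the box of `x, c`.
[cite: Dimock2004QED3TorusII, §3.1 (126)–(127) p.21 L11–23] -/
theorem box_stepToward_subset (x c : ι → ℤ) {u : ι → ℤ} (hu : InBox (stepToward x c) c u) : InBox x c u := by
  intro μ
  have h1 := hu μ
  have h2 := stepToward_mem_box x c μ
  constructor <;> omega

/-- **The straight king walk from `x` to `c` stays in the box of `x, c`**: if the weights are `≤ M` (`M ≥ 0`) on that
box, there is a walk `x → c` of cost `≤ M·supDist x c`. [cite: Dimock2004QED3TorusII, §3.1 (127) p.21 L16–23;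
§3.2 proof of Lemma 2 Part III (177) p.27 L61–65] -/
theorem exists_walk_cost_le_box {M : ℝ} (hM0 : 0 ≤ M) :
    ∀ (n : ℕ) (x c : ι → ℤ), supDist x c = n → (∀ u, InBox x c u → ρ u ≤ M) →
      ∃ p : Walk x c, p.cost ρ ≤ M * n
  | 0, x, c, h, _ => by
      obtain rfl := supDist_eq_zero_iff.1 h
      exact ⟨Walk.nil x, by simp⟩
  | n + 1, x, c, h, hM => by
      have h' : supDist (stepToward x c) c = n := by rw [supDist_stepToward, h]; rfl
      obtain ⟨p, hp⟩ := exists_walk_cost_le_box hM0 n (stepToward x c) c h'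
        (fun u hu => hM u (box_stepToward_subset x c hu))
      refine ⟨Walk.cons (adj_stepToward x c) p, ?_⟩
      rw [Walk.cost_cons]
      have hd1 : (supDist x (stepToward x c) : ℝ) ≤ 1 := by exact_mod_cast adj_stepToward x c
      have hd0 : (0 : ℝ) ≤ supDist x (stepToward x c) := Nat.cast_nonneg _
      have ha : (ρ x + ρ (stepToward x c)) / 2 ≤ M := by
        have h1 := hM x (inBox_left x c)
        have h2 := hM (stepToward x c) (stepToward_mem_box x c)
        linarith
      have hstep : (ρ x + ρ (stepToward x c)) / 2 * (supDist x (stepToward x c) : ℝ) ≤ M := by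
        nlinarith [mul_nonneg (sub_nonneg.2 ha) hd0, mul_nonneg hM0 (sub_nonneg.2 hd1)]
      push_cast
      linarith

/-- **Box-local upper bound**: weights `≥ 0`, and `≤ M` (`M ≥ 0`) on the box of `x, c`, give
`pathDist ρ x c ≤ M·supDist x c`. [cite: Dimock2004QED3TorusII, §3.2 proof of Lemma 2 Part III (177) p.27 L61–65] -/
theorem pathDist_le_box (hρ : ∀ u, 0 ≤ ρ u) {M : ℝ} (hM0 : 0 ≤ M) {x c : ι → ℤ}
    (hM : ∀ u, InBox x c u → ρ u ≤ M) : pathDist ρ x c ≤ M * supDist x c := by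
  obtain ⟨p, hp⟩ := exists_walk_cost_le_box hM0 (supDist x c) x c rfl hM
  exact (pathDist_le_cost hρ p).trans hp

end Box

section DimockBox

variable {a L : ℝ} {k : ℕ} {scale : (ι → ℤ) → ℕ}

omit [Fintype ι] in
/-- on scales `≥ i` the weight is `≤ a·L^{k−i}`. [cite: Dimock2004QED3TorusII, §3.1 (127) p.21 L16–23] -/
theorem dimockWeight_le_of_le_scale (ha : 0 ≤ a) (hL : 1 ≤ L) {i : ℕ} {u : ι → ℤ} (hu : i ≤ scale u) :
    dimockWeight a L k scale u ≤ a * L ^ (k - i) :=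
  mul_le_mul_of_nonneg_left (pow_le_pow_right₀ hL (by omega)) ha

/-- **(177), second inequality** (*"`d_{Ω(□)}(x,y) ≥ O(1)L^{(k−i)}d(x,y) ≥ O(1)d_Λ(x,y)`"*, i.e.
`d_Λ(x,y) ≤ O(1)L^{k−i}d(x,y)` for `x, y ∈ □^{(5)} ⊂ δΛ^{(k)}_i ∪ δΛ^{(k)}_{i+1}`): if every site of the box of `x, c` has
scale `≥ i` then `d_Λ(x,c) ≤ a·L^{k−i}·supDist x c` (`O(1) = 1` in this discretisation; `a·supDist` is the lattice
distance `d`). [cite: Dimock2004QED3TorusII, §3.2 proof of Lemma 2 Part III (177) p.27 L61–65] -/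
theorem dLambda_le_box (ha : 0 ≤ a) (hL : 1 ≤ L) {i : ℕ} {x c : ι → ℤ} (hbox : ∀ u, InBox x c u → i ≤ scale u) :
    dLambda a L k scale x c ≤ a * L ^ (k - i) * supDist x c :=
  pathDist_le_box (dimockWeight_nonneg ha (zero_le_one.trans hL))
    (mul_nonneg ha (pow_nonneg (zero_le_one.trans hL) _))
    (fun u hu => dimockWeight_le_of_le_scale ha hL (hbox u hu))

/-- **Every site of a block is `d_Λ`-close to its centre** (the engines' `hrad`): if `u` lies in the index cube of
half-width `n` about `c` (`|u_μ − c_μ| ≤ n ∀μ`) and every site of that cube has scale `≥ j`, then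
`d_Λ(u,c) ≤ a·L^{k−j}·n`; for the blocks `Δ ⊂ δΛ^{(k)}_j` of side `L^{−(k−j)}` (*"partition `L^{−k}Λ_0` into smaller blocks
`Δ` of size `L^{−(k−i)}` in `δΛ^{(k)}_i`"*), `n ≤ L^j∕2` and the bound is `≤ a·L^k∕2` (`= 1∕2` on `T^{−k}`), uniformly in
the scale. [cite: Dimock2004QED3TorusII, §3.2 proof of Thm 1 Part III p.24 L59–62, (153) p.24 L80–93] -/
theorem dLambda_le_of_mem_cube (ha : 0 ≤ a) (hL : 1 ≤ L) {j n : ℕ} {u c : ι → ℤ}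
    (hu : ∀ μ, |u μ - c μ| ≤ n) (hcube : ∀ v : ι → ℤ, (∀ μ, |v μ - c μ| ≤ n) → j ≤ scale v) :
    dLambda a L k scale u c ≤ a * L ^ (k - j) * n := by
  have hbox : ∀ v, InBox u c v → j ≤ scale v := by
    intro v hv
    refine hcube v fun μ => ?_
    have h1 := hv μ
    have h2 := hu μ
    rw [abs_le] at h2 ⊢
    constructor <;> omega
  have hd : (supDist u c : ℝ) ≤ n := by
    exact_mod_cast supDist_le_iff.2 fun μ => by have := hu μ; rw [abs_le] at this; omega
  calc dLambda a L k scale u c ≤ a * L ^ (k - j) * supDist u c := dLambda_le_box ha hL hbox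
    _ ≤ a * L ^ (k - j) * n :=
      mul_le_mul_of_nonneg_left hd (mul_nonneg ha (pow_nonneg (zero_le_one.trans hL) _))

end DimockBox

end QED3PathMetric

end Literature.MathematicalPhysics.QuantumFieldTheory.Dimock2011to13
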